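import Mathlib
import HarnessLib
import Literature.Analysis.Calculus.LineRestrictionIteratedDeriv
import Summits.HubbardSuperconductivity.HubbardSuperconductivity.Theorems.KLProgrammeC4aChordMidpointDepth

/-!
# Route `KLProgramme` — crux C4a, (U1) «(T)-MARGIN-PERTURBATIVE» part 1: the CHORD-MIDPOINT LEVEL DEPTH of the frame's Fermi sea WITHOUT the additive `2A`
# slack (multiplicative modulus `c/(6π²) − A/8 − A²/(4c)`)

Cell `gate-hubbard-kl`, seat hubbard-kl-k3c3-p3 (g35; row «implicit-function / monotonicity route for μ(n)»).  Helper for stub (C) `stub_twoLeg_curvature` of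
`KLRegimeEngineV17F2` (stmt-HubbardSuperconductivity-20437), the (C)-closer lane's (U1) assembly; answers the pen's (R383) «(T)-MARGIN-A» choice
(memo HOME/hubbard-kl-k3c3-p3/U1-CAUSTIC-SUP.md §16 addendum / §18).

WHY.  `…C4aChordMidpointDepth.frameLevel_midpoint_pairSum_le` compares the FREE levels of the two chart points `A = Φ(0,θ)`, `B = Φ(ρ,ϑ+θ)` and of the chord
midpoint `M` with the frame levels point by point (`|δ_K| ≤ A` three times), whence the additive slack `2A + |ρ|` and a tangency margin `ϑ_T ≍ √A`, NOT threshold-small.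
Here instead: (i) the free band's midpoint gain in GEOMETRIC-MEAN form (`cos²((a+b)/2) ≥ cos a cos b (1 + sin²((a−b)/2))`, parent §1) —
`P(M) ≥ √(P(A)P(B))·(1 + ‖A−B‖²/(6π²))` for `P = (cos x + cos y)/2` on the diamond; (ii) AM–GM between the two EXACT endpoint levels `c_A = −μ + δ_K(A) = 4P(A)`,
`c_B = −μ − ρ + δ_K(B) = 4P(B)`: `(c_A + c_B)/2 − √(c_A c_B) ≤ (c_A − c_B)²/(8c)`, with `|δ_K(A) − δ_K(B)| ≤ A‖A − B‖` (`‖Dδ_K‖ ≤ A`); (iii) the second difference of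
`δ_K` along the chord, `|δ_K(M) − (δ_K(A) + δ_K(B))/2| ≤ (A/8)‖A − B‖²` (`‖D²δ_K‖ ≤ A`, midpoint convexity of `s ↦ ±δ_K + (A‖A−B‖²/2)s²`).  RESULT (§3):
**`e_K(S/2) ≤ ρ/2 + ρ²/(4c) − (c/(6π²) − A/8 − A²/(4c))·‖A − B‖²`, `c = −μ − A − |ρ|`** — no additive `A`.  The Sizes corollaries (flat door
`A ≤ 1/200`, modulus `≥ 1/1000`, short chord `‖A − B‖² ≤ 10³(|ρ|/2 + 5ρ²/2 + K_cε/2)` ⇒ tangency margin THRESHOLD-SMALL) and the two dischargers of the (U1) arc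
theorems' primitive row «no direct-sheet caustic at scale `τ₀` off the tangency margin» are the sequel `…C4aDirectSheetExclusion`.
HONEST NOTE: some `A ≲ |μ|` door is necessary for any convexity-based exclusion at the window top (the free tangential Hessian on `{cos x + cos y = 0.05}` is `≈ |μ|/2`);
`1/200` is within a factor `≈ 4` of it.  Elementary real analysis on landed objects; nothing asserts (C), K3, the window or superconductivity.
References: FST II CPAM 51 (1998) §3 (H3) [cite: FeldmanSalmhoferTrubowitz1998]; BGM 2003 §7.1 Lemma 7.1 [cite: BenfattoGiulianiMastropietro2003];
BGM 2006 §2.4, App. A2 [cite: BenfattoGiulianiMastropietro2006].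
-/

noncomputable section

namespace Summit.HubbardSuperconductivity.HubbardSuperconductivity.Theorems.C4a

set_option linter.dupNamespace false -- summit = problem name (single-conjunct summit), D-0017

open Real Set
open Literature.MathematicalPhysics.QuantumLattice Literature.MathematicalPhysics.QuantumLattice.BandSectorCounting
open Literature.MathematicalPhysics.QuantumLattice.FermiRG
open Summit.HubbardSuperconductivity.HubbardSuperconductivity.Theorems.KLRegimeSplit
open Summit.HubbardSuperconductivity.HubbardSuperconductivity.Theorems.DispersionFlow
open Summit.HubbardSuperconductivity.HubbardSuperconductivity.Theorems.PerturbedFermiCurve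
open Literature.Analysis.Calculus

/-! ## §1 Calculus: first and second differences of a `C²` function along a chord -/

/-- **Second difference of a `C²` function of one variable**: `|g''| ≤ G` ⟹ `|g(1/2) − (g(0) + g(1))/2| ≤ G/8` (midpoint convexity of `±g + (G/2)s²` on `[0,1]`). -/
theorem abs_sub_midpoint_le_of_iteratedDeriv_two {g : ℝ → ℝ} (hg : ContDiff ℝ 2 g) {G : ℝ} (hG : ∀ s, |iteratedDeriv 2 g s| ≤ G) :
    |g (1 / 2) - (g 0 + g 1) / 2| ≤ G / 8 := by
  have key : ∀ σ : ℝ, |σ| = 1 → σ * g (1 / 2) - (σ * g 0 + σ * g 1) / 2 ≤ G / 8 := by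
    intro σ hσ
    set ψ : ℝ → ℝ := fun s => σ * g s + G / 2 * s ^ 2 with hψ
    have hsqC : ContDiff ℝ 2 (fun s : ℝ => s ^ 2) := contDiff_id.pow 2
    have hpoly : ContDiff ℝ 2 (fun s : ℝ => G / 2 * s ^ 2) := contDiff_const.mul hsqC
    have hσg : ContDiff ℝ 2 (fun s : ℝ => σ * g s) := contDiff_const.mul hg
    have hψC : ContDiff ℝ 2 ψ := hσg.add hpoly
    have hψ2 : ∀ s : ℝ, iteratedDeriv 2 ψ s = σ * iteratedDeriv 2 g s + G := fun s => by
      have h := iteratedDeriv_fun_add (n := 2) (x := s) (hσg.contDiffAt.of_le le_rfl) (hpoly.contDiffAt.of_le le_rfl)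
      have hsq2' : iteratedDeriv 2 (fun s : ℝ => s ^ 2) s = 2 := by
        rw [iteratedDeriv_pow]; simp [Nat.descFactorial]
      simp only [hψ]
      rw [h, iteratedDeriv_const_mul σ (hg.contDiffAt.of_le le_rfl), iteratedDeriv_const_mul (G / 2) (hsqC.contDiffAt.of_le le_rfl), hsq2']
      ring
    have hψconv : ConvexOn ℝ (Icc (0 : ℝ) 1) ψ := by
      refine convexOn_of_deriv2_nonneg (convex_Icc 0 1) hψC.continuous.continuousOn
        ((hψC.differentiable two_ne_zero).differentiableOn) ?_ fun x _ => ?_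
      · have hd : Differentiable ℝ (iteratedDeriv 1 ψ) := ContDiff.differentiable_iteratedDeriv 1 hψC (by norm_num)
        rw [iteratedDeriv_one] at hd
        exact hd.differentiableOn
      · have e : deriv^[2] ψ x = iteratedDeriv 2 ψ x := by rw [iteratedDeriv_eq_iterate]
        rw [e, hψ2]
        have h1 := hG x
        have h2 : -(|σ| * |iteratedDeriv 2 g x|) ≤ σ * iteratedDeriv 2 g x := by
          rw [← abs_mul]; exact neg_abs_le _
        rw [hσ, one_mul] at h2
        linarith
    have hj := hψconv.2 (left_mem_Icc.2 zero_le_one) (right_mem_Icc.2 zero_le_one) (show (0 : ℝ) ≤ 1 / 2 by norm_num)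
      (show (0 : ℝ) ≤ 1 / 2 by norm_num) (show (1 / 2 : ℝ) + 1 / 2 = 1 by norm_num)
    simp only [hψ, smul_eq_mul] at hj
    norm_num at hj
    linarith
  have h₁ := key 1 (by simp)
  have h₂ := key (-1) (by simp)
  rw [abs_le]; constructor <;> linarith

section Line

variable {V : Type*} [NormedAddCommGroup V] [NormedSpace ℝ V]

/-- **Second difference along a chord**: `f ∈ C²`, `‖D²f‖ ≤ K` ⟹ `|f((P+Q)/2) − (f(P) + f(Q))/2| ≤ (K/8)‖P − Q‖²`. -/
theorem abs_apply_midpoint_sub_le {f : V → ℝ} (hf : ContDiff ℝ 2 f) {K : ℝ} (hK : ∀ x, ‖iteratedFDeriv ℝ 2 f x‖ ≤ K) (P Q : V) :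
    |f ((1 / 2 : ℝ) • (P + Q)) - (f P + f Q) / 2| ≤ K / 8 * ‖P - Q‖ ^ 2 := by
  set g : ℝ → ℝ := fun s => f (P + s • (Q - P)) with hgdef
  have hg : ContDiff ℝ 2 g := contDiff_lineRestriction hf P (Q - P)
  have hG : ∀ s, |iteratedDeriv 2 g s| ≤ K * ‖Q - P‖ ^ 2 := fun s => by
    have h := norm_iteratedDeriv_lineRestriction_le_of_le (n := 2) hf hK P (Q - P) s
    rwa [Real.norm_eq_abs] at h
  have h := abs_sub_midpoint_le_of_iteratedDeriv_two hg hG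
  have e0 : g 0 = f P := by simp [hgdef]
  have e1 : g 1 = f Q := by simp [hgdef]
  have eM : g (1 / 2) = f ((1 / 2 : ℝ) • (P + Q)) := by
    simp only [hgdef]; congr 1; module
  rw [e0, e1, eM, norm_sub_rev] at h
  calc |f ((1 / 2 : ℝ) • (P + Q)) - (f P + f Q) / 2| ≤ K * ‖P - Q‖ ^ 2 / 8 := h
    _ = K / 8 * ‖P - Q‖ ^ 2 := by ring

/-- **First difference along a chord**: `f ∈ C¹`, `‖Df‖ ≤ K` ⟹ `|f(P) − f(Q)| ≤ K‖P − Q‖`. -/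
theorem abs_apply_sub_apply_le {f : V → ℝ} (hf : ContDiff ℝ 1 f) {K : ℝ} (hK : ∀ x, ‖iteratedFDeriv ℝ 1 f x‖ ≤ K) (P Q : V) :
    |f P - f Q| ≤ K * ‖P - Q‖ := by
  have hdiff : ∀ x ∈ (univ : Set V), DifferentiableAt ℝ f x := fun x _ => (hf.differentiable one_ne_zero) x
  have hbound : ∀ x ∈ (univ : Set V), ‖fderiv ℝ f x‖ ≤ K := fun x _ => by rw [← norm_iteratedFDeriv_one]; exact hK x
  have h := (convex_univ (𝕜 := ℝ) (E := V)).norm_image_sub_le_of_norm_fderiv_le hdiff hbound (mem_univ Q) (mem_univ P)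
  rwa [Real.norm_eq_abs] at h

end Line

/-! ## §2 AM–GM with a quantitative remainder; the free midpoint gain in geometric-mean form -/

/-- `m ≤ c₁, c₂`, `0 ≤ m` ⟹ `m ≤ √(c₁c₂)`. -/
theorem le_sqrt_mul_of_le {c₁ c₂ m : ℝ} (hm : 0 ≤ m) (h₁ : m ≤ c₁) (h₂ : m ≤ c₂) : m ≤ Real.sqrt (c₁ * c₂) := by
  rw [show m = Real.sqrt (m * m) by rw [Real.sqrt_mul_self hm]]
  exact Real.sqrt_le_sqrt (mul_le_mul h₁ h₂ hm (hm.trans h₁))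

/-- **AM–GM with remainder**: `0 < m ≤ c₁, c₂` ⟹ `(c₁ + c₂)/2 − √(c₁c₂) ≤ (c₁ − c₂)²/(8m)` (`AM − GM = (AM² − GM²)/(AM + GM)`, `AM + GM ≥ 2m`). -/
theorem half_add_sub_sqrt_mul_le {c₁ c₂ m : ℝ} (hm : 0 < m) (h₁ : m ≤ c₁) (h₂ : m ≤ c₂) :
    (c₁ + c₂) / 2 - Real.sqrt (c₁ * c₂) ≤ (c₁ - c₂) ^ 2 / (8 * m) := by
  set G := Real.sqrt (c₁ * c₂) with hGdef
  have hG0 : 0 ≤ G := Real.sqrt_nonneg _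
  have hGsq : G ^ 2 = c₁ * c₂ := by rw [hGdef, Real.sq_sqrt (mul_nonneg (hm.le.trans h₁) (hm.le.trans h₂))]
  have hGm : m ≤ G := le_sqrt_mul_of_le hm.le h₁ h₂
  have hprod : ((c₁ + c₂) / 2 - G) * ((c₁ + c₂) / 2 + G) = (c₁ - c₂) ^ 2 / 4 := by nlinarith [hGsq]
  have hAG : 0 ≤ (c₁ + c₂) / 2 - G := by nlinarith [hGsq, sq_nonneg (c₁ - c₂), hG0, hm.le.trans h₁, hm.le.trans h₂]
  have hden : 2 * m ≤ (c₁ + c₂) / 2 + G := by linarith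
  rw [le_div_iff₀ (by positivity)]
  nlinarith [mul_le_mul_of_nonneg_left hden hAG]

/-- **MIDPOINT GAIN of `(cos x + cos y)/2` on the diamond, geometric-mean form**: for two points of `{|x ± y| < π}` and any `0 ≤ g` with
`g² ≤ P(k₁)·P(k₂)` (`P = (cos x + cos y)/2`), at the midpoint `P(k_M) ≥ g·(1 + ((x₁−x₂)² + (y₁−y₂)²)/(6π²))` — no common lower level needed
(parent `halfCosSum_midpoint_ge` is the case `g = m ≤ P(k_i)`). [cite: FeldmanSalmhoferTrubowitz1998, §3 (H3)] -/
theorem halfCosSum_midpoint_ge_geomMean {x₁ y₁ x₂ y₂ g : ℝ} (hg : 0 ≤ g)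
    (hg2 : g ^ 2 ≤ (Real.cos x₁ + Real.cos y₁) / 2 * ((Real.cos x₂ + Real.cos y₂) / 2))
    (hd₁ : |x₁ + y₁| < π) (hd₁' : |x₁ - y₁| < π) (hd₂ : |x₂ + y₂| < π) (hd₂' : |x₂ - y₂| < π) :
    g * (1 + ((x₁ - x₂) ^ 2 + (y₁ - y₂) ^ 2) / (6 * π ^ 2)) ≤
      (Real.cos ((x₁ + x₂) / 2) + Real.cos ((y₁ + y₂) / 2)) / 2 := by
  have hπ := Real.pi_pos
  set u₁ := (x₁ + y₁) / 2 with hu₁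
  set v₁ := (x₁ - y₁) / 2 with hv₁
  set u₂ := (x₂ + y₂) / 2 with hu₂
  set v₂ := (x₂ - y₂) / 2 with hv₂
  have hu₁a : |u₁| < π / 2 := by rw [hu₁, abs_div, abs_two]; linarith
  have hv₁a : |v₁| < π / 2 := by rw [hv₁, abs_div, abs_two]; linarith
  have hu₂a : |u₂| < π / 2 := by rw [hu₂, abs_div, abs_two]; linarith
  have hv₂a : |v₂| < π / 2 := by rw [hv₂, abs_div, abs_two]; linarith
  have hcos_pos : ∀ t : ℝ, |t| < π / 2 → 0 < Real.cos t := fun t ht =>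
    Real.cos_pos_of_mem_Ioo ⟨by linarith [(abs_lt.1 ht).1], (abs_lt.1 ht).2⟩
  have hcu₁ := hcos_pos u₁ hu₁a
  have hcv₁ := hcos_pos v₁ hv₁a
  have hcu₂ := hcos_pos u₂ hu₂a
  have hcv₂ := hcos_pos v₂ hv₂a
  have hP₁ : (Real.cos x₁ + Real.cos y₁) / 2 = Real.cos u₁ * Real.cos v₁ := halfCosSum_eq x₁ y₁
  have hP₂ : (Real.cos x₂ + Real.cos y₂) / 2 = Real.cos u₂ * Real.cos v₂ := halfCosSum_eq x₂ y₂
  have hPM : (Real.cos ((x₁ + x₂) / 2) + Real.cos ((y₁ + y₂) / 2)) / 2 = Real.cos ((u₁ + u₂) / 2) * Real.cos ((v₁ + v₂) / 2) := by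
    rw [halfCosSum_eq, show ((x₁ + x₂) / 2 + (y₁ + y₂) / 2) / 2 = (u₁ + u₂) / 2 by rw [hu₁, hu₂]; ring,
      show ((x₁ + x₂) / 2 - (y₁ + y₂) / 2) / 2 = (v₁ + v₂) / 2 by rw [hv₁, hv₂]; ring]
  rw [hP₁, hP₂] at hg2
  -- midpoint gains in `u` and in `v`
  have gu := mul_le_cos_sq_half_sum u₁ u₂
  have gv := mul_le_cos_sq_half_sum v₁ v₂
  set su := Real.sin ((u₁ - u₂) / 2) ^ 2 with hsu
  set sv := Real.sin ((v₁ - v₂) / 2) ^ 2 with hsv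
  set cM := Real.cos ((u₁ + u₂) / 2) with hcM
  set dM := Real.cos ((v₁ + v₂) / 2) with hdM
  have hcMpos : 0 < cM := hcos_pos _ (by
    rw [abs_div, abs_two]; have := abs_add_le u₁ u₂; linarith)
  have hdMpos : 0 < dM := hcos_pos _ (by
    rw [abs_div, abs_two]; have := abs_add_le v₁ v₂; linarith)
  have hsu0 : 0 ≤ su := sq_nonneg _
  have hsv0 : 0 ≤ sv := sq_nonneg _
  have hsu1 : su ≤ 1 := by rw [hsu]; exact Real.sin_sq_le_one _
  have hsv1 : sv ≤ 1 := by rw [hsv]; exact Real.sin_sq_le_one _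
  have hP1pos : 0 < Real.cos u₁ * Real.cos v₁ := mul_pos hcu₁ hcv₁
  have hP2pos : 0 < Real.cos u₂ * Real.cos v₂ := mul_pos hcu₂ hcv₂
  have step1 : (Real.cos u₁ * Real.cos v₁) * (Real.cos u₂ * Real.cos v₂) * ((1 + su) * (1 + sv)) ≤ cM ^ 2 * dM ^ 2 := by
    have e := mul_le_mul gu gv (by positivity) (sq_nonneg _)
    calc _ = Real.cos u₁ * Real.cos u₂ * (1 + su) * (Real.cos v₁ * Real.cos v₂ * (1 + sv)) := by ring
      _ ≤ cM ^ 2 * dM ^ 2 := e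
  set σ := su + sv with hσ
  have hσ0 : 0 ≤ σ := by rw [hσ]; positivity
  have hσ3 : σ ≤ 3 := by rw [hσ]; linarith
  have step3 : g ^ 2 * (1 + σ) ≤ cM ^ 2 * dM ^ 2 := by
    have hX : 1 + σ ≤ (1 + su) * (1 + sv) := by
      have e : (1 + su) * (1 + sv) = 1 + (su + sv) + su * sv := by ring
      rw [e, hσ]; linarith [mul_nonneg hsu0 hsv0]
    calc g ^ 2 * (1 + σ) ≤ g ^ 2 * ((1 + su) * (1 + sv)) := mul_le_mul_of_nonneg_left hX (sq_nonneg g)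
      _ ≤ (Real.cos u₁ * Real.cos v₁) * (Real.cos u₂ * Real.cos v₂) * ((1 + su) * (1 + sv)) :=
          mul_le_mul_of_nonneg_right hg2 (by positivity)
      _ ≤ cM ^ 2 * dM ^ 2 := step1
  have step4 : (g * (1 + σ / 3)) ^ 2 ≤ (cM * dM) ^ 2 := by
    have h13 : (1 + σ / 3) ^ 2 ≤ 1 + σ := by
      have hnn : 0 ≤ σ * (3 - σ) / 9 := div_nonneg (mul_nonneg hσ0 (by linarith)) (by norm_num)
      calc (1 + σ / 3) ^ 2 = 1 + σ - σ * (3 - σ) / 9 := by ring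
        _ ≤ 1 + σ := by linarith
    calc (g * (1 + σ / 3)) ^ 2 = g ^ 2 * (1 + σ / 3) ^ 2 := by ring
      _ ≤ g ^ 2 * (1 + σ) := mul_le_mul_of_nonneg_left h13 (sq_nonneg g)
      _ ≤ cM ^ 2 * dM ^ 2 := step3
      _ = (cM * dM) ^ 2 := by ring
  have step5 : g * (1 + σ / 3) ≤ cM * dM :=
    (pow_le_pow_iff_left₀ (by positivity) (mul_pos hcMpos hdMpos).le two_ne_zero).1 step4
  -- Jordan in `u` and `v`, and `(Δu)² + (Δv)² = ((Δx)² + (Δy)²)/2`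
  have hdu : |u₁ - u₂| ≤ π := by have := abs_sub u₁ u₂; linarith
  have hdv : |v₁ - v₂| ≤ π := by have := abs_sub v₁ v₂; linarith
  have ju := sq_div_pi_sq_le_sin_sq_half hdu
  have jv := sq_div_pi_sq_le_sin_sq_half hdv
  have hgeom : ((x₁ - x₂) ^ 2 + (y₁ - y₂) ^ 2) / (6 * π ^ 2) ≤ σ / 3 := by
    have e1 : ((u₁ - u₂) / π) ^ 2 + ((v₁ - v₂) / π) ^ 2 = ((x₁ - x₂) ^ 2 + (y₁ - y₂) ^ 2) / (2 * π ^ 2) := by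
      rw [hu₁, hu₂, hv₁, hv₂]; field_simp; ring
    have e2 : ((x₁ - x₂) ^ 2 + (y₁ - y₂) ^ 2) / (2 * π ^ 2) ≤ σ := by rw [← e1, hσ, hsu, hsv]; exact add_le_add ju jv
    have e3 : ((x₁ - x₂) ^ 2 + (y₁ - y₂) ^ 2) / (6 * π ^ 2) = ((x₁ - x₂) ^ 2 + (y₁ - y₂) ^ 2) / (2 * π ^ 2) / 3 := by
      field_simp; ring
    rw [e3]; linarith
  rw [hPM]
  calc g * (1 + ((x₁ - x₂) ^ 2 + (y₁ - y₂) ^ 2) / (6 * π ^ 2)) ≤ g * (1 + σ / 3) := mul_le_mul_of_nonneg_left (by linarith) hg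
    _ ≤ cM * dM := step5

/-- **Midpoint level depth of the FREE dispersion, geometric-mean form**: under the hypotheses of `halfCosSum_midpoint_ge_geomMean` for
`k₁, k₂ : Fin 2 → ℝ`, `ε₀((k₁+k₂)/2) ≤ −4g·(1 + ((k₁−k₂)₀² + (k₁−k₂)₁²)/(6π²))` (`ε₀ = −2(cos k₀ + cos k₁)`, `(4g)² ≤ ε₀(k₁)ε₀(k₂)`).
[cite: FeldmanSalmhoferTrubowitz1998, §3 (H3)] -/
theorem sqDispersion_midpoint_le_geomMean {k₁ k₂ : Fin 2 → ℝ} {g : ℝ} (hg : 0 ≤ g)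
    (hg2 : g ^ 2 ≤ (Real.cos (k₁ 0) + Real.cos (k₁ 1)) / 2 * ((Real.cos (k₂ 0) + Real.cos (k₂ 1)) / 2))
    (hd₁ : |k₁ 0 + k₁ 1| < π) (hd₁' : |k₁ 0 - k₁ 1| < π) (hd₂ : |k₂ 0 + k₂ 1| < π)
    (hd₂' : |k₂ 0 - k₂ 1| < π) :
    sqDispersion ((1 / 2 : ℝ) • (k₁ + k₂)) ≤ -(4 * g) * (1 + ((k₁ 0 - k₂ 0) ^ 2 + (k₁ 1 - k₂ 1) ^ 2) / (6 * π ^ 2)) := by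
  have h := halfCosSum_midpoint_ge_geomMean hg hg2 hd₁ hd₁' hd₂ hd₂'
  have e0 : ((1 / 2 : ℝ) • (k₁ + k₂)) 0 = (k₁ 0 + k₂ 0) / 2 := by simp [Pi.smul_apply]; ring
  have e1 : ((1 / 2 : ℝ) • (k₁ + k₂)) 1 = (k₁ 1 + k₂ 1) / 2 := by simp [Pi.smul_apply]; ring
  simp only [sqDispersion, e0, e1]
  linarith


/-! ## §3 The frame: PERTURBATIVE level depth of the midpoint of the chord `[Φ(0,θ), Φ(ρ,ϑ+θ)]` (no additive `A`) -/

section Band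

variable {a b : ℝ} (B : BandBounds a b) {K : TrigPolyC4v} {A : ℝ} (hA : ∀ p : Momentum, ∀ j ≤ 2, ‖iteratedFDeriv ℝ j (frameShift K) p‖ ≤ A)
  {μ : ℝ}
include B hA

/-- **PERTURBATIVE LEVEL DEPTH OF THE CHORD MIDPOINT (frame)**: for the chart points `A = Φ(0,θ)` (level `0`) and `B = Φ(ρ,ϑ+θ)` (level `ρ`) of an admissible
frame (`‖Dʲδ_K‖ ≤ A`, `j ≤ 2`; both free levels in `[a, b] ⊂ (−4, 0)`; `c := −μ − A − |ρ| > 0`), the frame band at the midpoint `S/2 = (A + B)/2` satisfies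
`e_K(S/2) ≤ ρ/2 + ρ²/(4c) − (c/(6π²) − A/8 − A²/(4c))·‖A − B‖²` — the free gain in geometric-mean form, AM–GM between the exact endpoint levels, and the first /
second differences of `δ_K` along the chord; NO additive `A` slack (compare the parent's `2A + |ρ| − (c/(6π²))‖A − B‖²`). [cite: FeldmanSalmhoferTrubowitz1998, §3 (H3)] -/
theorem frameLevel_midpoint_pairSum_le_perturbative {ρ : ℝ} (hlo₀ : a ≤ μ + 0 - A) (hhi₀ : μ + 0 + A ≤ b) (hlo : a ≤ μ + ρ - A) (hhi : μ + ρ + A ≤ b)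
    (hneg : μ + A + |ρ| < 0) (ϑ θ : ℝ) :
    frameLevel μ K ((1 / 2 : ℝ) • (levelPoint μ K 0 θ + levelPoint μ K ρ (ϑ + θ))) ≤
      ρ / 2 + ρ ^ 2 / (4 * (-μ - A - |ρ|)) -
        ((-μ - A - |ρ|) / (6 * π ^ 2) - A / 8 - A ^ 2 / (4 * (-μ - A - |ρ|))) * ‖levelPoint μ K 0 θ - levelPoint μ K ρ (ϑ + θ)‖ ^ 2 := by
  set P := levelPoint μ K 0 θ with hPdef
  set Q := levelPoint μ K ρ (ϑ + θ) with hQdef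
  obtain ⟨hε₁, hsq₁⟩ := sqDispersion_levelPoint_eq B hA hlo₀ hhi₀ θ
  obtain ⟨hε₂, hsq₂⟩ := sqDispersion_levelPoint_eq B hA hlo hhi (ϑ + θ)
  rw [← hPdef] at hε₁ hsq₁; rw [← hQdef] at hε₂ hsq₂
  have hA0 : 0 ≤ A := le_trans (norm_nonneg _) (hA 0 0 (by norm_num))
  have hfs₁ : |frameShift K P| ≤ A := by rw [hPdef, levelPoint_eq_toLp_smul_dir]; exact abs_frameShift_toLp_le hA _
  have hfs₂ : |frameShift K Q| ≤ A := by rw [hQdef, levelPoint_eq_toLp_smul_dir]; exact abs_frameShift_toLp_le hA _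
  set k₁ : Fin 2 → ℝ := WithLp.ofLp P with hk₁
  set k₂ : Fin 2 → ℝ := WithLp.ofLp Q with hk₂
  set M : Momentum := (1 / 2 : ℝ) • (P + Q) with hMdef
  have hMk : WithLp.ofLp M = (1 / 2 : ℝ) • (k₁ + k₂) := by simp [hMdef, hk₁, hk₂]
  have hM : frameLevel μ K M = sqDispersion (WithLp.ofLp M) + frameShift K M - μ := by
    have := frameLevel_toLp μ K (WithLp.ofLp M); simpa using this
  -- the first and second differences of `δ_K` along the chord
  have hC2 : ContDiff ℝ 2 (frameShift K) := contDiff_frameShift K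
  have hC1 : ContDiff ℝ 1 (frameShift K) := contDiff_frameShift K
  have hD1 : |frameShift K P - frameShift K Q| ≤ A * ‖P - Q‖ :=
    abs_apply_sub_apply_le hC1 (fun x => hA x 1 (by norm_num)) P Q
  have hD2 : |frameShift K M - (frameShift K P + frameShift K Q) / 2| ≤ A / 8 * ‖P - Q‖ ^ 2 :=
    abs_apply_midpoint_sub_le hC2 (fun x => hA x 2 le_rfl) P Q
  have hsqD : (frameShift K P - frameShift K Q) ^ 2 ≤ A ^ 2 * ‖P - Q‖ ^ 2 := by
    have h := pow_le_pow_left₀ (abs_nonneg _) hD1 2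
    rwa [sq_abs, mul_pow] at h
  -- name the three values of `δ_K`, the squared chord and the level floor
  obtain ⟨δP, hδP⟩ : ∃ x, frameShift K P = x := ⟨_, rfl⟩
  obtain ⟨δQ, hδQ⟩ : ∃ x, frameShift K Q = x := ⟨_, rfl⟩
  obtain ⟨δM, hδM⟩ : ∃ x, frameShift K M = x := ⟨_, rfl⟩
  rw [hδP] at hε₁ hfs₁ hD2 hsqD; rw [hδQ] at hε₂ hfs₂ hD2 hsqD; rw [hδM] at hD2
  obtain ⟨m, hmdef⟩ : ∃ x, x = -μ - A - |ρ| := ⟨_, rfl⟩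
  have hm : 0 < m := by rw [hmdef]; linarith
  have hρ₁ := le_abs_self ρ
  have hρ₂ := neg_abs_le ρ
  have h₁ : m ≤ -μ + δP := by rw [hmdef]; have := (abs_le.1 hfs₁).1; linarith [abs_nonneg ρ]
  have h₂ : m ≤ -μ - ρ + δQ := by rw [hmdef]; have := (abs_le.1 hfs₂).1; linarith
  have hcos₁ : (Real.cos (k₁ 0) + Real.cos (k₁ 1)) / 2 = (-μ + δP) / 4 := by
    have e : (Real.cos (k₁ 0) + Real.cos (k₁ 1)) / 2 = -(sqDispersion k₁) / 4 := by simp only [sqDispersion]; ring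
    rw [e, hε₁]; ring
  have hcos₂ : (Real.cos (k₂ 0) + Real.cos (k₂ 1)) / 2 = (-μ - ρ + δQ) / 4 := by
    have e : (Real.cos (k₂ 0) + Real.cos (k₂ 1)) / 2 = -(sqDispersion k₂) / 4 := by simp only [sqDispersion]; ring
    rw [e, hε₂]; ring
  -- both points lie in the open diamond
  have hpos₁ : 0 < Real.cos (k₁ 0) + Real.cos (k₁ 1) := by linarith
  have hpos₂ : 0 < Real.cos (k₂ 0) + Real.cos (k₂ 1) := by linarith
  have hdia₁ := abs_add_abs_lt_pi_of_cos_add_cos_pos (hsq₁ 0) (hsq₁ 1) hpos₁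
  have hdia₂ := abs_add_abs_lt_pi_of_cos_add_cos_pos (hsq₂ 0) (hsq₂ 1) hpos₂
  have hd₁ : |k₁ 0 + k₁ 1| < π := (abs_add_le _ _).trans_lt hdia₁
  have hd₁' : |k₁ 0 - k₁ 1| < π := (abs_sub _ _).trans_lt hdia₁
  have hd₂ : |k₂ 0 + k₂ 1| < π := (abs_add_le _ _).trans_lt hdia₂
  have hd₂' : |k₂ 0 - k₂ 1| < π := (abs_sub _ _).trans_lt hdia₂
  -- the geometric mean of the endpoint levels
  set G := Real.sqrt ((-μ + δP) * (-μ - ρ + δQ)) with hGdef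
  have hc₁0 : 0 ≤ -μ + δP := hm.le.trans h₁
  have hc₂0 : 0 ≤ -μ - ρ + δQ := hm.le.trans h₂
  have hG0 : 0 ≤ G := Real.sqrt_nonneg _
  have hGsq : G ^ 2 = (-μ + δP) * (-μ - ρ + δQ) := by rw [hGdef, Real.sq_sqrt (mul_nonneg hc₁0 hc₂0)]
  have hGm : m ≤ G := le_sqrt_mul_of_le hm.le h₁ h₂
  have hg0 : 0 ≤ G / 4 := by positivity
  have hg2 : (G / 4) ^ 2 ≤ (Real.cos (k₁ 0) + Real.cos (k₁ 1)) / 2 * ((Real.cos (k₂ 0) + Real.cos (k₂ 1)) / 2) := by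
    have e : (G / 4) ^ 2 = (-μ + δP) / 4 * ((-μ - ρ + δQ) / 4) := by rw [div_pow, hGsq]; ring
    rw [hcos₁, hcos₂, e]
  have hmid := sqDispersion_midpoint_le_geomMean hg0 hg2 hd₁ hd₁' hd₂ hd₂'
  -- the distance
  have hdist : (k₁ 0 - k₂ 0) ^ 2 + (k₁ 1 - k₂ 1) ^ 2 = ‖P - Q‖ ^ 2 := by
    rw [norm_sq_eq_add_sq]; simp [hk₁, hk₂]
  rw [hdist] at hmid
  obtain ⟨L, hLdef⟩ : ∃ x, ‖P - Q‖ ^ 2 = x := ⟨_, rfl⟩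
  have hL0 : 0 ≤ L := by rw [← hLdef]; exact sq_nonneg _
  rw [hLdef] at hmid hD2 hsqD ⊢
  -- AM–GM with remainder, and the level difference through `δ_K`
  have hAMGM := half_add_sub_sqrt_mul_le hm h₁ h₂
  rw [← hGdef] at hAMGM
  have hdiff : ((-μ + δP) - (-μ - ρ + δQ)) ^ 2 ≤ 2 * ρ ^ 2 + 2 * (A ^ 2 * L) := by
    have e : ((-μ + δP) - (-μ - ρ + δQ)) ^ 2 = (ρ + (δP - δQ)) ^ 2 := by ring
    have hid : 2 * ρ ^ 2 + 2 * (δP - δQ) ^ 2 - (ρ + (δP - δQ)) ^ 2 = (ρ - (δP - δQ)) ^ 2 := by ring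
    have hnn := sq_nonneg (ρ - (δP - δQ))
    rw [e]; linarith only [hid, hnn, hsqD]
  have hquot : ((-μ + δP) - (-μ - ρ + δQ)) ^ 2 / (8 * m) ≤ (2 * ρ ^ 2 + 2 * (A ^ 2 * L)) / (8 * m) :=
    div_le_div_of_nonneg_right hdiff (by positivity)
  have hsplit : (2 * ρ ^ 2 + 2 * (A ^ 2 * L)) / (8 * m) = ρ ^ 2 / (4 * m) + A ^ 2 / (4 * m) * L := by
    field_simp; ring
  -- the gain term: `G·L/(6π²) ≥ m·L/(6π²)`
  have hgain : m / (6 * π ^ 2) * L ≤ G * (L / (6 * π ^ 2)) := by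
    have h : m * L ≤ G * L := mul_le_mul_of_nonneg_right hGm hL0
    have hπ : 0 < 6 * π ^ 2 := by positivity
    calc m / (6 * π ^ 2) * L = m * L / (6 * π ^ 2) := by ring
      _ ≤ G * L / (6 * π ^ 2) := div_le_div_of_nonneg_right h hπ.le
      _ = G * (L / (6 * π ^ 2)) := by ring
  -- assemble
  rw [hM, hMk, hδM, ← hmdef]
  have hδM2 := (abs_le.1 hD2).2
  have hmid' : sqDispersion ((1 / 2 : ℝ) • (k₁ + k₂)) ≤ -G - G * (L / (6 * π ^ 2)) := by
    have e : -(4 * (G / 4)) * (1 + L / (6 * π ^ 2)) = -G - G * (L / (6 * π ^ 2)) := by ring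
    rw [← e]; exact hmid
  generalize sqDispersion ((1 / 2 : ℝ) • (k₁ + k₂)) = sM at hmid' ⊢
  have htarget : ρ / 2 + ρ ^ 2 / (4 * m) - (m / (6 * π ^ 2) - A / 8 - A ^ 2 / (4 * m)) * L =
      ρ / 2 + (ρ ^ 2 / (4 * m) + A ^ 2 / (4 * m) * L) + A / 8 * L - m / (6 * π ^ 2) * L := by ring
  rw [htarget]
  linarith [hmid', hAMGM, hquot, hsplit, hgain, hδM2]

end Band

end Summit.HubbardSuperconductivity.HubbardSuperconductivity.Theorems.C4a

end
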